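import Literature.Probability.Percolation.DiscreteDomainPaths
import Literature.Probability.Percolation.PlanarDuality
import Literature.Probability.Percolation.FourArmGarbanSquareDomain
import Mathlib.Analysis.Complex.ReImTopology

/-!
# Box exhaustion for the collinear half-plane Cardy statement, part 1: the discretised box

Support file (line `Sketch`, stub `stub_collinearCardy`, crux `HalfPlaneMarkDensityLaw`,
stmt-CriticalPhenomena-5661; transfer `RectilinearCardy → stub_collinearCardy`).

The open box `Ω = (-K, K) × (0, H)` (written `Ioo (-K) K ×ℂ Ioo 0 H` throughout) under the tree's
discretisation recipe (`meshVertices`, `meshDomain` = largest mesh component, `discreteDomainGraph`,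
`meshBoundary`, `discreteArc`, Smirnov 2001 §2) at mesh `δ`:

* the mesh graph of the box is connected, so `meshDomain Ω δ = meshVertices Ω δ`
  (`meshDomain_boxDomain`) and `Ω_δ` is the nearest-neighbour graph on the lattice box
  (`discreteDomainGraph_adj_boxDomain`);
* the frontier of the box is the union of its four closed sides (`mem_frontier_boxDomain`) and a
  point is at least as far from it as from the nearest side (`le_dist_of_mem_frontier_boxDomain`).

Part 2 identifies the discrete arcs of bottom segments and relates paths of `Ω_δ` to lattice paths.
No definitions are introduced (the box and the bottom segments are written out).
-/

noncomputable section

namespace Summit.CriticalPhenomena.CardyFormulaZ2.Cruxes.HalfPlaneMarkDensityLaw.SketchLine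

open Set Metric Complex
open Literature.Probability.LatticeModels Literature.Probability.Percolation

variable {K H δ : ℝ}

namespace BoxExhaustion

/-! ## The box and its mesh vertices -/

/-- Membership in the box. [folklore] -/
theorem mem_boxDomain {z : ℂ} :
    z ∈ Ioo (-K) K ×ℂ Ioo 0 H ↔ (-K < z.re ∧ z.re < K) ∧ (0 < z.im ∧ z.im < H) := by
  simp [mem_reProdIm]

/-- The box is open. [folklore] -/
theorem isOpen_boxDomain : IsOpen (Ioo (-K) K ×ℂ Ioo 0 H) := isOpen_Ioo.reProdIm isOpen_Ioo

/-- The box is convex. [folklore] -/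
theorem convex_boxDomain : Convex ℝ (Ioo (-K) K ×ℂ Ioo 0 H) :=
  ((convex_Ioo _ _).linear_preimage reLm).inter ((convex_Ioo _ _).linear_preimage imLm)

/-- Mesh vertices of the box. [folklore] -/
theorem mem_meshVertices_boxDomain {v : Site 2} :
    v ∈ meshVertices (Ioo (-K) K ×ℂ Ioo 0 H) δ ↔
      (-K < δ * v 0 ∧ δ * v 0 < K) ∧ (0 < δ * v 1 ∧ δ * v 1 < H) := by
  rw [mem_meshVertices_iff, mem_boxDomain, meshPoint_re, meshPoint_im]

/-- Mesh vertices of the box, bounds divided by the mesh. [folklore] -/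
theorem mem_meshVertices_boxDomain_div (hδ : 0 < δ) {v : Site 2} :
    v ∈ meshVertices (Ioo (-K) K ×ℂ Ioo 0 H) δ ↔
      (-K / δ < v 0 ∧ (v 0 : ℝ) < K / δ) ∧ (0 < v 1 ∧ (v 1 : ℝ) < H / δ) := by
  rw [mem_meshVertices_boxDomain, lt_div_iff₀ hδ, div_lt_iff₀ hδ, lt_div_iff₀ hδ, mul_comm (v 0 : ℝ),
    mul_comm (v 1 : ℝ)]
  constructor
  · rintro ⟨⟨h1, h2⟩, h3, h4⟩
    refine ⟨⟨by linarith, h2⟩, ?_, h4⟩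
    have : (0 : ℝ) < v 1 := pos_of_mul_pos_right (by linarith) hδ.le
    exact_mod_cast this
  · rintro ⟨⟨h1, h2⟩, h3, h4⟩
    have h3' : (0 : ℝ) < v 1 := by exact_mod_cast h3
    exact ⟨⟨by linarith, h2⟩, mul_pos hδ h3', h4⟩

/-- Lattice neighbours inside the box are mesh-adjacent (the box is convex). [folklore] -/
theorem meshGraph_adj_boxDomain {x y : Site 2} (hx : x ∈ meshVertices (Ioo (-K) K ×ℂ Ioo 0 H) δ)
    (hy : y ∈ meshVertices (Ioo (-K) K ×ℂ Ioo 0 H) δ) (hxy : (zdGraph 2).Adj x y) :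
    (meshGraph (Ioo (-K) K ×ℂ Ioo 0 H) δ).Adj x y :=
  meshGraph_adj_iff.2 ⟨hxy, (convex_boxDomain.segment_subset hx hy).trans subset_closure⟩

/-- **The mesh graph of the box is connected**: two mesh vertices are joined by a column move
followed by a row move inside the lattice box. [folklore] -/
theorem preconnected_meshVertexGraph_boxDomain (hδ : 0 < δ) :
    (meshVertexGraph (Ioo (-K) K ×ℂ Ioo 0 H) δ).Preconnected := by
  set V := meshVertices (Ioo (-K) K ×ℂ Ioo 0 H) δ with hV
  set G := meshVertexGraph (Ioo (-K) K ×ℂ Ioo 0 H) δ with hG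
  -- sites in coordinates
  have st_eta : ∀ v : Site 2, (![v 0, v 1] : Site 2) = v := fun v => by
    ext k; fin_cases k <;> rfl
  have adj_up : ∀ i j : ℤ, (zdGraph 2).Adj (![i, j] : Site 2) ![i, j + 1] := fun i j => by
    rw [zdGraph_adj_iff]
    refine ⟨1, Or.inl ?_⟩
    ext k; fin_cases k <;> simp
  have adj_right : ∀ i j : ℤ, (zdGraph 2).Adj (![i, j] : Site 2) ![i + 1, j] := fun i j => by
    rw [zdGraph_adj_iff]
    refine ⟨0, Or.inl ?_⟩
    ext k; fin_cases k <;> simp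
  have memV : ∀ i j : ℤ, (![i, j] : Site 2) ∈ V ↔
      (-K / δ < i ∧ (i : ℝ) < K / δ) ∧ (0 < j ∧ (j : ℝ) < H / δ) := fun i j => by
    rw [hV, mem_meshVertices_boxDomain_div hδ]; simp
  have adjG : ∀ {a b : Site 2} (ha : a ∈ V) (hb : b ∈ V), (zdGraph 2).Adj a b →
      G.Adj ⟨a, ha⟩ ⟨b, hb⟩ := by
    intro a b ha hb hab
    simp only [hG, SimpleGraph.comap_adj, Function.Embedding.coe_subtype]
    exact meshGraph_adj_boxDomain ha hb hab
  -- column moves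
  have hcol : ∀ (i j : ℤ) (m : ℕ) (h0 : (![i, j] : Site 2) ∈ V) (h1 : (![i, j + m] : Site 2) ∈ V),
      G.Reachable ⟨![i, j], h0⟩ ⟨![i, j + m], h1⟩ := by
    intro i j m
    induction m with
    | zero =>
      intro h0 h1
      have e : (⟨![i, j + ((0 : ℕ) : ℤ)], h1⟩ : V) = ⟨![i, j], h0⟩ := Subtype.ext (by simp)
      rw [e]
    | succ m ih =>
      intro h0 h1
      have h0' := (memV _ _).1 h0
      have h1' := (memV _ _).1 h1
      simp only [Int.cast_add, Int.cast_natCast, Nat.cast_succ] at h1'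
      have hmid : (![i, j + m] : Site 2) ∈ V := by
        rw [memV]
        simp only [Int.cast_add, Int.cast_natCast]
        have hm : (0 : ℝ) ≤ m := Nat.cast_nonneg m
        refine ⟨h0'.1, ?_, by linarith [h1'.2.2]⟩
        have : (0 : ℤ) < j := h0'.2.1
        omega
      refine (ih h0 hmid).trans (SimpleGraph.Adj.reachable (adjG hmid h1 ?_))
      have := adj_up i (j + m)
      push_cast
      rwa [← add_assoc]
  have hcol' : ∀ (i j j' : ℤ) (h0 : (![i, j] : Site 2) ∈ V) (h1 : (![i, j'] : Site 2) ∈ V),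
      G.Reachable ⟨![i, j], h0⟩ ⟨![i, j'], h1⟩ := by
    intro i j j' h0 h1
    rcases le_total j j' with h | h
    · obtain ⟨m, rfl⟩ : ∃ m : ℕ, j' = j + m := ⟨(j' - j).toNat, by omega⟩
      exact hcol i j m h0 h1
    · obtain ⟨m, rfl⟩ : ∃ m : ℕ, j = j' + m := ⟨(j - j').toNat, by omega⟩
      exact (hcol i j' m h1 h0).symm
  -- row moves
  have hrow : ∀ (i j : ℤ) (m : ℕ) (h0 : (![i, j] : Site 2) ∈ V) (h1 : (![i + m, j] : Site 2) ∈ V),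
      G.Reachable ⟨![i, j], h0⟩ ⟨![i + m, j], h1⟩ := by
    intro i j m
    induction m with
    | zero =>
      intro h0 h1
      have e : (⟨![i + ((0 : ℕ) : ℤ), j], h1⟩ : V) = ⟨![i, j], h0⟩ := Subtype.ext (by simp)
      rw [e]
    | succ m ih =>
      intro h0 h1
      have h0' := (memV _ _).1 h0
      have h1' := (memV _ _).1 h1
      simp only [Int.cast_add, Int.cast_natCast, Nat.cast_succ] at h1'
      have hmid : (![i + m, j] : Site 2) ∈ V := by
        rw [memV]
        simp only [Int.cast_add, Int.cast_natCast]
        have hm : (0 : ℝ) ≤ m := Nat.cast_nonneg m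
        exact ⟨⟨by linarith [h0'.1.1], by linarith [h1'.1.2]⟩, h0'.2⟩
      refine (ih h0 hmid).trans (SimpleGraph.Adj.reachable (adjG hmid h1 ?_))
      have := adj_right (i + m) j
      push_cast
      rwa [← add_assoc]
  have hrow' : ∀ (i i' j : ℤ) (h0 : (![i, j] : Site 2) ∈ V) (h1 : (![i', j] : Site 2) ∈ V),
      G.Reachable ⟨![i, j], h0⟩ ⟨![i', j], h1⟩ := by
    intro i i' j h0 h1
    rcases le_total i i' with h | h
    · obtain ⟨m, rfl⟩ : ∃ m : ℕ, i' = i + m := ⟨(i' - i).toNat, by omega⟩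
      exact hrow i j m h0 h1
    · obtain ⟨m, rfl⟩ : ∃ m : ℕ, i = i' + m := ⟨(i - i').toNat, by omega⟩
      exact (hrow i' j m h1 h0).symm
  rintro ⟨u, hu⟩ ⟨v, hv⟩
  have hu0 : (![u 0, u 1] : Site 2) ∈ V := by rwa [st_eta]
  have hv0 : (![v 0, v 1] : Site 2) ∈ V := by rwa [st_eta]
  have hu' := (memV _ _).1 hu0
  have hv' := (memV _ _).1 hv0
  have hw : (![u 0, v 1] : Site 2) ∈ V := (memV _ _).2 ⟨hu'.1, hv'.2⟩
  have e1 : (⟨![u 0, u 1], hu0⟩ : V) = ⟨u, hu⟩ := Subtype.ext (st_eta u)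
  have e2 : (⟨![v 0, v 1], hv0⟩ : V) = ⟨v, hv⟩ := Subtype.ext (st_eta v)
  have h := (hcol' (u 0) (u 1) (v 1) hu0 hw).trans (hrow' (u 0) (v 0) (v 1) hw hv0)
  rwa [e1, e2] at h

/-- **The discrete box is the whole lattice box**: `meshDomain = meshVertices` for the box
(tree: `meshDomain_eq_meshVertices_of_preconnected`). [folklore] -/
theorem meshDomain_boxDomain (hδ : 0 < δ) :
    meshDomain (Ioo (-K) K ×ℂ Ioo 0 H) δ = meshVertices (Ioo (-K) K ×ℂ Ioo 0 H) δ :=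
  meshDomain_eq_meshVertices_of_preconnected (preconnected_meshVertexGraph_boxDomain hδ)

/-- Adjacency in `Ω_δ` for the box is lattice adjacency between mesh vertices. [folklore] -/
theorem discreteDomainGraph_adj_boxDomain (hδ : 0 < δ) {x y : Site 2} :
    (discreteDomainGraph (Ioo (-K) K ×ℂ Ioo 0 H) δ).Adj x y ↔
      (zdGraph 2).Adj x y ∧ x ∈ meshVertices (Ioo (-K) K ×ℂ Ioo 0 H) δ ∧
        y ∈ meshVertices (Ioo (-K) K ×ℂ Ioo 0 H) δ := by
  rw [discreteDomainGraph_adj_iff, meshDomain_boxDomain hδ]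
  constructor
  · rintro ⟨h, hx, hy⟩; exact ⟨(meshGraph_adj_iff.1 h).1, hx, hy⟩
  · rintro ⟨h, hx, hy⟩; exact ⟨meshGraph_adj_boxDomain hx hy h, hx, hy⟩

/-! ## The frontier of the box -/

/-- The frontier of the box: the four closed sides. [folklore] -/
theorem mem_frontier_boxDomain (hK : 0 < K) (hH : 0 < H) {q : ℂ} :
    q ∈ frontier (Ioo (-K) K ×ℂ Ioo 0 H) ↔
      (q.re ∈ Icc (-K) K ∧ (q.im = 0 ∨ q.im = H)) ∨ ((q.re = -K ∨ q.re = K) ∧ q.im ∈ Icc 0 H) := by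
  rw [frontier_reProdIm, closure_Ioo (by linarith : (-K) ≠ K), frontier_Ioo hH,
    closure_Ioo hH.ne, frontier_Ioo (by linarith : -K < K)]
  simp [mem_reProdIm]

/-- Bottom points of the closed box lie on the frontier. [folklore] -/
theorem ofReal_mem_frontier_boxDomain (hK : 0 < K) (hH : 0 < H) {x : ℝ} (hx : x ∈ Icc (-K) K) :
    (x : ℂ) ∈ frontier (Ioo (-K) K ×ℂ Ioo 0 H) :=
  (mem_frontier_boxDomain hK hH).2 (Or.inl ⟨by simpa using hx, Or.inl (by simp)⟩)

/-- Top points of the closed box lie on the frontier. [folklore] -/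
theorem top_mem_frontier_boxDomain (hK : 0 < K) (hH : 0 < H) {x : ℝ} (hx : x ∈ Icc (-K) K) :
    (x : ℂ) + H * I ∈ frontier (Ioo (-K) K ×ℂ Ioo 0 H) :=
  (mem_frontier_boxDomain hK hH).2 (Or.inl ⟨by simpa using hx, Or.inr (by simp)⟩)

/-- Distance from a point to the frontier of the box is at least the distance to the nearest side.
[folklore] -/
theorem le_dist_of_mem_frontier_boxDomain (hK : 0 < K) (hH : 0 < H) {p q : ℂ}
    (hq : q ∈ frontier (Ioo (-K) K ×ℂ Ioo 0 H)) :
    min (min p.im (H - p.im)) (K - |p.re|) ≤ dist p q := by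
  have him : |(p - q).im| ≤ dist p q := by rw [dist_eq_norm]; exact abs_im_le_norm _
  have hre : |(p - q).re| ≤ dist p q := by rw [dist_eq_norm]; exact abs_re_le_norm _
  rw [sub_im] at him
  rw [sub_re] at hre
  rcases (mem_frontier_boxDomain hK hH).1 hq with ⟨-, h | h⟩ | ⟨h | h, -⟩
  · rw [h, sub_zero] at him
    exact (min_le_left _ _).trans ((min_le_left _ _).trans ((le_abs_self _).trans him))
  · rw [h] at him
    refine (min_le_left _ _).trans ((min_le_right _ _).trans (le_trans ?_ him))
    rw [abs_sub_comm]; exact le_abs_self _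
  · rw [h, sub_neg_eq_add] at hre
    refine (min_le_right _ _).trans (le_trans ?_ hre)
    have := neg_abs_le p.re
    calc K - |p.re| ≤ p.re + K := by linarith
      _ ≤ |p.re + K| := le_abs_self _
  · rw [h] at hre
    refine (min_le_right _ _).trans (le_trans ?_ hre)
    have := le_abs_self p.re
    calc K - |p.re| ≤ K - p.re := by linarith
      _ ≤ |p.re - K| := by rw [abs_sub_comm]; exact le_abs_self _

/-- Distance from a mesh point to the foot of its perpendicular on the bottom side. [folklore] -/
theorem dist_meshPoint_ofReal_le (hδ : 0 ≤ δ) (v : Site 2) (hv : 0 ≤ (v 1 : ℝ)) :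
    dist (meshPoint δ v) ((δ * v 0 : ℝ) : ℂ) ≤ δ * v 1 := by
  rw [dist_eq_norm]
  refine (norm_le_abs_re_add_abs_im _).trans ?_
  simp [abs_of_nonneg (mul_nonneg hδ hv)]

/-- Distance from a mesh point to the point of the top side above it. [folklore] -/
theorem dist_meshPoint_top_le (v : Site 2) (h : δ * v 1 ≤ H) :
    dist (meshPoint δ v) (((δ * v 0 : ℝ) : ℂ) + H * I) ≤ H - δ * v 1 := by
  rw [dist_eq_norm]
  refine (norm_le_abs_re_add_abs_im _).trans ?_
  simp only [sub_re, meshPoint_re, add_re, ofReal_re, mul_re, ofReal_im, I_re, mul_zero, I_im,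
    sub_self, add_zero, abs_zero, zero_add, sub_im, meshPoint_im, add_im, mul_im, mul_one]
  rw [abs_sub_comm, abs_of_nonneg (by linarith)]

/-- Every point of the real axis is at distance at least the height from a point above the axis.
[folklore] -/
theorem im_le_dist_of_im_eq_zero {p a : ℂ} (ha : a.im = 0) (hp : 0 ≤ p.im) : p.im ≤ dist p a := by
  have him : |(p - a).im| ≤ dist p a := by rw [dist_eq_norm]; exact abs_im_le_norm _
  rw [sub_im, ha, sub_zero, abs_of_nonneg hp] at him
  exact him

/-- A point of the real axis not directly below `p` is at distance more than the height.
[folklore] -/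
theorem im_lt_dist_of_re_ne {p a : ℂ} (ha : a.im = 0) (hre : p.re ≠ a.re) : p.im < dist p a := by
  rw [dist_eq_norm]
  have h2 : p.im ^ 2 < ‖p - a‖ ^ 2 := by
    rw [Complex.sq_norm, Complex.normSq_apply, sub_re, sub_im, ha, sub_zero]
    have : (p.re - a.re) * (p.re - a.re) > 0 := mul_self_pos.2 (sub_ne_zero.2 hre)
    nlinarith
  exact lt_of_pow_lt_pow_left₀ 2 (norm_nonneg _) h2

/-- Integer sites with `0 < δ m` have `1 ≤ m`. [folklore] -/
theorem one_le_of_mul_pos (hδ : 0 < δ) {m : ℤ} (h : 0 < δ * m) : 1 ≤ m := by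
  have : (0 : ℝ) < m := pos_of_mul_pos_right h hδ.le
  have : (0 : ℤ) < m := by exact_mod_cast this
  omega

end BoxExhaustion

/-- Registered stub of this support file (part 1 of the box exhaustion): the discrete box is the whole
lattice box. [folklore] -/
theorem stub_boxExhaustion_meshDomain :
    ∀ K H δ : ℝ, 0 < δ →
      meshDomain (Ioo (-K) K ×ℂ Ioo 0 H) δ = meshVertices (Ioo (-K) K ×ℂ Ioo 0 H) δ :=
  fun _ _ _ hδ => BoxExhaustion.meshDomain_boxDomain hδ

end Summit.CriticalPhenomena.CardyFormulaZ2.Cruxes.HalfPlaneMarkDensityLaw.SketchLine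

end
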